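import Mathlib
import Summits.MatrixMultiplication.MatrixMultiplication.Theses.SemilatticeSTPP

/-!
# Line `registered` of crux `SemilatticeSTPP.Thesis` (stmt-MatrixMultiplication-5969):
# two semilattice-host lemmas — type rigidity in semilattice powers, and fibre antichains

Hosts of the crux include SEMILATTICES = commutative idempotent monoids (product = join, identity = bottom), with
the natural order `v ≤ w :↔ v * w = w`.  This file proves the two registered host lemmas of the negative idea
"Clifford matching dichotomy":

* `typeRigidity` — in the power `Yⁿ` of a finite semilattice `Y`, if the pointwise product `x * y` has the same
  letter histogram as `x` (for every `e : Y`, `#{j : x j = e} = #{j : (x * y) j = e}`), then `x * y = x`.  Proof: the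
  rank `r v := #{u : u * v = v}` (the size of the down-set of `v`) is monotone along the natural order
  (`downsetCard_le_of_mul_eq`) and strictly monotone on strict comparabilities (`downsetCard_lt_of_mul_eq_of_ne`);
  termwise `x j ≤ (x * y) j`; equal histograms give `Σ_j r (x j) = Σ_j r ((x * y) j)` because a rank sum only sees
  the histogram (`sum_downsetCard_eq_sum_fibre`, via `Finset.sum_fiberwise'`); so the ranks agree termwise
  (`Finset.sum_eq_sum_iff_of_le`), whence `(x * y) j = x j` for every `j`.
* `fibre_antichain_of_idempotent` — in a semilattice host of a monoid-TPP family (iff-form), for a fixed block `i`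
  and fixed `s` the α-fibre `t ↦ α(s,t)` is an antichain for the natural order, and so is the β-fibre `t ↦ β(t,u)`
  for fixed `u`.  Proof: `α(s,t) ≤ α(s,t')` forces `α(s,t')·β(t,u) = α(s,t')·γ(s,u) = γ(s,u)` (the last step because
  `α(s,t') ≤ γ(s,u) = α(s,t')·β(t',u)` by idempotency), and the TPP iff then reads `t' = t`; symmetrically for β.

Mathlib + the route file only; no cited facts; sorry-free.
-/

set_option linter.dupNamespace false
-- (single-conjunct summit: the namespace repeats `MatrixMultiplication`)

namespace Summit.MatrixMultiplication.MatrixMultiplication.Theorems.SemilatticeSTPPThesis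

/-- Down-sets grow along the natural order of a commutative monoid: if `v * w = w` (`v ≤ w`) then every `u` with
`u * v = v` has `u * w = u * (v * w) = (u * v) * w = w`, so the down-set rank `#{u : u * v = v}` of `v` is at most
that of `w`. [folklore] -/
theorem downsetCard_le_of_mul_eq {Y : Type} [CommMonoid Y] [Fintype Y] [DecidableEq Y] {v w : Y}
    (h : v * w = w) :
    (Finset.univ.filter fun u => u * v = v).card ≤ (Finset.univ.filter fun u => u * w = w).card := by
  refine Finset.card_le_card fun u hu => ?_
  simp only [Finset.mem_filter, Finset.mem_univ, true_and] at hu ⊢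
  rw [← h, ← mul_assoc, hu]

/-- Strict growth of down-sets in a commutative IDEMPOTENT monoid: if `v * w = w` and `v ≠ w` then `w` lies in the
down-set of `w` (`w * w = w`) but not in that of `v` (else `v = w * v = v * w = w`), so the down-set rank of `v` is
strictly below that of `w`. [folklore] -/
theorem downsetCard_lt_of_mul_eq_of_ne {Y : Type} [CommMonoid Y] [Fintype Y] [DecidableEq Y]
    (hid : ∀ x : Y, x * x = x) {v w : Y} (h : v * w = w) (hne : v ≠ w) :
    (Finset.univ.filter fun u => u * v = v).card < (Finset.univ.filter fun u => u * w = w).card := by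
  refine Finset.card_lt_card ⟨fun u hu => ?_, fun hsub => hne ?_⟩
  · simp only [Finset.mem_filter, Finset.mem_univ, true_and] at hu ⊢
    rw [← h, ← mul_assoc, hu]
  · have hw : w ∈ Finset.univ.filter fun u => u * w = w := by
      simp only [Finset.mem_filter, Finset.mem_univ, true_and]
      exact hid w
    have hwv := hsub hw
    simp only [Finset.mem_filter, Finset.mem_univ, true_and] at hwv
    calc v = w * v := hwv.symm
      _ = v * w := mul_comm _ _
      _ = w := h

/-- A sum of down-set ranks over the letters of a word only sees the letter histogram:
`Σ_j r (x j) = Σ_e #{j : x j = e} · r e` for `r e := #{u : u * e = e}` (`Finset.sum_fiberwise'`). [folklore] -/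
theorem sum_downsetCard_eq_sum_fibre {Y : Type} [CommMonoid Y] [Fintype Y] [DecidableEq Y] {n : ℕ}
    (x : Fin n → Y) :
    ∑ j, (Finset.univ.filter fun u => u * x j = x j).card =
      ∑ e, (Finset.univ.filter fun j => x j = e).card * (Finset.univ.filter fun u => u * e = e).card := by
  rw [← Finset.sum_fiberwise' Finset.univ x fun e => (Finset.univ.filter fun u => u * e = e).card]
  refine Finset.sum_congr rfl fun e _ => ?_
  simp only [Finset.sum_const, smul_eq_mul]

/-- **Type rigidity in semilattice powers (RB4).**  In the power `Yⁿ` of a finite commutative idempotent monoid, if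
the pointwise product `x * y` has the same letter histogram as `x` then `x * y = x`: the down-set rank is monotone
along `x j ≤ (x * y) j` and strictly so when `x j ≠ (x * y) j`, while equal histograms give equal rank sums, so all
the termwise inequalities are equalities. [folklore] -/
theorem typeRigidity :
    ∀ (Y : Type) [CommMonoid Y] [Fintype Y] [DecidableEq Y], (∀ x : Y, x * x = x) →
      ∀ (n : ℕ) (x y : Fin n → Y),
        (∀ e : Y, (Finset.univ.filter fun j => x j = e).card =
          (Finset.univ.filter fun j => (x * y) j = e).card) →
        x * y = x := by
  intro Y _ _ _ hid n x y hcard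
  -- `x j ≤ (x * y) j` in the natural order
  have hle : ∀ j, x j * (x * y) j = (x * y) j := fun j => by
    rw [Pi.mul_apply, ← mul_assoc, hid (x j)]
  -- equal histograms ⇒ equal rank sums
  have hsum : ∑ j, (Finset.univ.filter fun u => u * x j = x j).card =
      ∑ j, (Finset.univ.filter fun u => u * (x * y) j = (x * y) j).card := by
    rw [sum_downsetCard_eq_sum_fibre x, sum_downsetCard_eq_sum_fibre (x * y)]
    exact Finset.sum_congr rfl fun e _ => by rw [hcard e]
  -- termwise `≤` with equal sums ⇒ termwise `=`
  have heq := (Finset.sum_eq_sum_iff_of_le fun j _ => downsetCard_le_of_mul_eq (hle j)).1 hsum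
  funext j
  by_contra hne
  exact absurd (heq j (Finset.mem_univ j))
    (ne_of_lt (downsetCard_lt_of_mul_eq_of_ne hid (hle j) (Ne.symm hne)))

/-- **Fibre antichains (RB5).**  In a commutative idempotent host of a monoid-TPP family (iff-form), for a fixed
block `i`, fixed `s : Fin (a i)` and fixed `u : Fin (c i)`: if `α(s,t) ≤ α(s,t')` (i.e.
`α(s,t) * α(s,t') = α(s,t')`) then `t = t'`, and if `β(t,u) ≤ β(t',u)` then `t = t'`.  Indeed
`α(s,t')·β(t,u) = α(s,t')·(α(s,t)·β(t,u)) = α(s,t')·γ(s,u) = α(s,t')·α(s,t')·β(t',u) = γ(s,u)`, and the TPP iff at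
`x = (s,t')`, `y = (t,u)`, `z = (s,u)` reads `t' = t`; symmetrically for β. [folklore] -/
theorem fibre_antichain_of_idempotent :
    ∀ (M : Type) [CommMonoid M], (∀ v : M, v * v = v) →
      ∀ (p : ℕ) (a b c : Fin p → ℕ) (α : (Σ i, Fin (a i) × Fin (b i)) → M)
        (β : (Σ i, Fin (b i) × Fin (c i)) → M) (γ : (Σ i, Fin (a i) × Fin (c i)) → M),
        (∀ x y z, α x * β y = γ z ↔
          (z.1 = x.1 ∧ x.1 = y.1 ∧ (z.2.1 : ℕ) = x.2.1 ∧ (x.2.2 : ℕ) = y.2.1 ∧ (z.2.2 : ℕ) = y.2.2)) →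
        ∀ (i : Fin p) (s : Fin (a i)) (u : Fin (c i)) (t t' : Fin (b i)),
          (α ⟨i, (s, t)⟩ * α ⟨i, (s, t')⟩ = α ⟨i, (s, t')⟩ → t = t') ∧
          (β ⟨i, (t, u)⟩ * β ⟨i, (t', u)⟩ = β ⟨i, (t', u)⟩ → t = t') := by
  intro M _ hid p a b c α β γ htpp i s u t t'
  -- matched instances of the TPP iff inside block `i`
  have hm : ∀ t₀ : Fin (b i), α ⟨i, (s, t₀)⟩ * β ⟨i, (t₀, u)⟩ = γ ⟨i, (s, u)⟩ := fun t₀ =>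
    (htpp ⟨i, (s, t₀)⟩ ⟨i, (t₀, u)⟩ ⟨i, (s, u)⟩).2 ⟨rfl, rfl, rfl, rfl, rfl⟩
  refine ⟨fun h => ?_, fun h => ?_⟩
  · -- `α(s,t) ≤ α(s,t')` forces the mismatched product `α(s,t')·β(t,u)` onto `γ(s,u)`
    have key : α ⟨i, (s, t')⟩ * β ⟨i, (t, u)⟩ = γ ⟨i, (s, u)⟩ :=
      calc α ⟨i, (s, t')⟩ * β ⟨i, (t, u)⟩
          = α ⟨i, (s, t)⟩ * α ⟨i, (s, t')⟩ * β ⟨i, (t, u)⟩ := by rw [h]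
        _ = α ⟨i, (s, t')⟩ * (α ⟨i, (s, t)⟩ * β ⟨i, (t, u)⟩) := by
          rw [mul_comm (α ⟨i, (s, t)⟩) (α ⟨i, (s, t')⟩), mul_assoc]
        _ = α ⟨i, (s, t')⟩ * (α ⟨i, (s, t')⟩ * β ⟨i, (t', u)⟩) := by rw [hm t, hm t']
        _ = α ⟨i, (s, t')⟩ * α ⟨i, (s, t')⟩ * β ⟨i, (t', u)⟩ := by rw [mul_assoc]
        _ = γ ⟨i, (s, u)⟩ := by rw [hid, hm t']
    have hx := (htpp ⟨i, (s, t')⟩ ⟨i, (t, u)⟩ ⟨i, (s, u)⟩).1 key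
    exact Fin.ext hx.2.2.2.1.symm
  · -- `β(t,u) ≤ β(t',u)` forces the mismatched product `α(s,t)·β(t',u)` onto `γ(s,u)`
    have key : α ⟨i, (s, t)⟩ * β ⟨i, (t', u)⟩ = γ ⟨i, (s, u)⟩ :=
      calc α ⟨i, (s, t)⟩ * β ⟨i, (t', u)⟩
          = α ⟨i, (s, t)⟩ * (β ⟨i, (t, u)⟩ * β ⟨i, (t', u)⟩) := by rw [h]
        _ = α ⟨i, (s, t)⟩ * β ⟨i, (t, u)⟩ * β ⟨i, (t', u)⟩ := by rw [mul_assoc]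
        _ = α ⟨i, (s, t')⟩ * β ⟨i, (t', u)⟩ * β ⟨i, (t', u)⟩ := by rw [hm t, hm t']
        _ = α ⟨i, (s, t')⟩ * (β ⟨i, (t', u)⟩ * β ⟨i, (t', u)⟩) := by rw [mul_assoc]
        _ = γ ⟨i, (s, u)⟩ := by rw [hid, hm t']
    have hx := (htpp ⟨i, (s, t)⟩ ⟨i, (t', u)⟩ ⟨i, (s, u)⟩).1 key
    exact Fin.ext hx.2.2.2.1

end Summit.MatrixMultiplication.MatrixMultiplication.Theorems.SemilatticeSTPPThesis
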